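import Mathlib
import Summits.KontsevichZagierPeriods.KontsevichZagierPeriods.Theorems.SoloInformedRatBand
import HarnessLib
import HarnessLib.Audit

/-!
# SoloInformed — the ONE-BRANCH CELL LEAVES (PRES-RAT(2), Phase IV-2)

Solo programme `solo-KontsevichZagierPeriods-informed`, session s110.  The leaves of the
PRES-RAT(2) recursion at a GENERIC BOUNDARY POINT (GEN-E): after rescaling the cell to the unit
square, the boundary of the domain inside the cell is ONE smooth real branch `y = a(x)` of a
nonzero `K`-polynomial `H` — the real trace `a = Re A` of a complex-analytic implicit branch `A`
(`soloInformed_exists_cxImplicit`) — with `0 < a < 1` on `(0,1)` and such that the real zeros of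
`H` in the open unit square are exactly the graph of `a` (the uniqueness window of the implicit
function theorem contains the cell).  We package this as `SoloInformedUnitBranch` and prove:

* `SoloInformedUnitBranch.isSemialgebraicFunOn_a` — `a` is a `ℚ`-semialgebraic function on
  `(0,1)` (its graph is `{H = 0} ∩ (0,1)²`, a `ℚ`-semialgebraic set since `K ⊆ ℚ̄ ∩ ℝ`);
* `SoloInformedUnitBranch.presentable_upper` / `presentable_lower` — **CELL LEAVES**: an
  integral representation with domain the upper piece `{0 < x < 1, a(x) < y < 1}` or the lower
  piece `{0 < x < 1, 0 < y < a(x)}` of the open unit square and integrand a `K`-rational function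
  `N/D` with `D ≠ 0` on the closed unit square is presentable (RATIONAL BAND THEOREM with one
  `K`-constant boundary).

References: Kontsevich–Zagier 2001 §1.2; Bochnak–Coste–Roy 1998 §2.2, Prop. 8.1.8; folklore.
-/

noncomputable section

open scoped BigOperators Topology
open MeasureTheory Set Filter Metric
open Literature.NumberTheory.Transcendental Literature.NumberTheory.Transcendental.KZ
open Literature.ModelTheory.ExponentialFields (IsSemialgebraic)

namespace Summit.KontsevichZagierPeriods.KontsevichZagierPeriods.Theorems

/-! ### Pairs in the unit square -/

/-- Membership of a pair in the open square. -/
theorem soloInformed_vec2_mem_openCube {s t : ℝ} :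
    (![s, t] : Fin 2 → ℝ) ∈ soloInformedOpenCube 2 ↔ (0 < s ∧ s < 1) ∧ (0 < t ∧ t < 1) := by
  rw [soloInformed_mem_openCube_iff, Fin.forall_fin_two]
  rfl

/-- Membership of a pair in the closed square. -/
theorem soloInformed_vec2_mem_cube {s t : ℝ} :
    (![s, t] : Fin 2 → ℝ) ∈ soloInformedCube 2 ↔ (0 ≤ s ∧ s ≤ 1) ∧ (0 ≤ t ∧ t ≤ 1) := by
  rw [soloInformed_mem_cube_iff, Fin.forall_fin_two]
  rfl

variable {K : Type*} [Field K] [Algebra K ℝ]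

/-! ### Unit branch data -/

/-- **Unit branch data.**  An implicit branch `A` of a nonzero `K`-polynomial `H` on an open
`V ⊆ ℂ` containing `[0,1]`, analytic and real on reals, with real trace `a = Re A` valued in
`(0,1)` on `(0,1)`, such that the real zeros of `H` in the open unit square lie on the graph of
`a`. [this work] -/
structure SoloInformedUnitBranch (K : Type*) [Field K] [Algebra K ℝ] where
  /-- the branch polynomial -/
  H : MvPolynomial (Fin 2) K
  /-- the complex branch -/
  A : ℂ → ℂ
  /-- a complex neighbourhood of `[0,1]` -/
  V : Set ℂ
  /-- `H ≠ 0` -/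
  H_ne : H ≠ 0
  /-- `V` is open -/
  isOpen_V : IsOpen V
  /-- `V ⊇ [0,1]` -/
  mem_V : ∀ x : ℝ, x ∈ Icc (0 : ℝ) 1 → (x : ℂ) ∈ V
  /-- `A` is analytic on `V` -/
  analyticA : AnalyticOnNhd ℂ A V
  /-- `A` is real on real points -/
  realA : ∀ x : ℝ, (x : ℂ) ∈ V → (A x).im = 0
  /-- `H(z, A z) = 0` on `V` -/
  zero : ∀ z ∈ V, soloInformedEvalC (soloInformedKToC K) H z (A z) = 0
  /-- the real zeros of `H` in the open square lie on the graph -/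
  uniq : ∀ s t : ℝ, 0 < s → s < 1 → 0 < t → t < 1 →
    (MvPolynomial.aeval ![s, t] H : ℝ) = 0 → t = (A s).re
  /-- the branch stays inside the open square -/
  inside : ∀ s : ℝ, 0 < s → s < 1 → 0 < (A s).re ∧ (A s).re < 1

namespace SoloInformedUnitBranch

/-- The real branch `a = Re A`. [this work] -/
def a (β : SoloInformedUnitBranch K) (s : ℝ) : ℝ := (β.A s).re

/-- At a real point of `V`, `A = a`. -/
theorem A_ofReal (β : SoloInformedUnitBranch K) {s : ℝ} (hs : (s : ℂ) ∈ β.V) :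
    β.A s = (β.a s : ℂ) :=
  Complex.ext (by simp [a]) (by simpa [a] using β.realA s hs)

/-- `a` is continuous on `[0,1]`. -/
theorem continuousOn_a (β : SoloInformedUnitBranch K) : ContinuousOn β.a (Icc 0 1) := by
  have h1 : ContinuousOn (fun s : ℝ => β.A s) (Icc 0 1) :=
    β.analyticA.continuousOn.comp Complex.continuous_ofReal.continuousOn fun s hs => β.mem_V s hs
  exact Complex.continuous_re.comp_continuousOn h1

/-- On the closed interval, `0 ≤ a ≤ 1`. -/
theorem a_mem_Icc (β : SoloInformedUnitBranch K) {s : ℝ} (hs : s ∈ Icc (0 : ℝ) 1) :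
    0 ≤ β.a s ∧ β.a s ≤ 1 := by
  have hcl : closure (Ioo (0 : ℝ) 1) = Icc 0 1 := closure_Ioo zero_ne_one
  have himg : β.a '' closure (Ioo (0 : ℝ) 1) ⊆ closure (β.a '' Ioo 0 1) :=
    (β.continuousOn_a.mono (by rw [hcl])).image_closure
  have hsub : β.a '' Ioo (0 : ℝ) 1 ⊆ Icc 0 1 := by
    rintro _ ⟨u, hu, rfl⟩
    exact ⟨(β.inside u hu.1 hu.2).1.le, (β.inside u hu.1 hu.2).2.le⟩
  have hmem : β.a s ∈ closure (β.a '' Ioo 0 1) :=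
    himg ⟨s, by rw [hcl]; exact hs, rfl⟩
  exact closure_minimal hsub isClosed_Icc hmem

/-- In the open square, `H = 0` exactly on the graph of `a`. -/
theorem aeval_eq_zero_iff (β : SoloInformedUnitBranch K) {z : Fin 2 → ℝ}
    (hz : z ∈ soloInformedOpenCube 2) :
    (MvPolynomial.aeval z β.H : ℝ) = 0 ↔ z 1 = β.a (z 0) := by
  constructor
  · intro h
    have hz2 : z = ![z 0, z 1] := by
      funext i
      fin_cases i
      · rfl
      · rfl
    rw [hz2] at h
    exact β.uniq _ _ (hz 0).1 (hz 0).2 (hz 1).1 (hz 1).2 h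
  · intro h
    have hV : ((z 0 : ℝ) : ℂ) ∈ β.V := β.mem_V _ ⟨(hz 0).1.le, (hz 0).2.le⟩
    have hpt : soloInformedToC 2 z = ![((z 0 : ℝ) : ℂ), β.A (z 0)] := by
      funext i
      fin_cases i
      · simp [soloInformedToC_apply]
      · simp [soloInformedToC_apply, h, β.A_ofReal hV]
    have h0 := β.zero _ hV
    unfold soloInformedEvalC at h0
    rw [← hpt, ← soloInformed_ofReal_aevalK] at h0
    exact_mod_cast h0

/-- The graph of `a` over `(0,1)` is `{H = 0} ∩ (0,1)²`. -/
theorem graph_a_eq (β : SoloInformedUnitBranch K) :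
    {z : Fin (1 + 1) → ℝ | ∃ x ∈ soloInformedOpenCube 1, z = Fin.snoc x (β.a (x 0))} =
      {z | z ∈ soloInformedOpenCube 2 ∧ (MvPolynomial.aeval z β.H : ℝ) = 0} := by
  have hsnoc : ∀ (x : Fin 1 → ℝ) (w : ℝ), (Fin.snoc x w : Fin 2 → ℝ) = ![x 0, w] := fun x w => by
    funext i
    fin_cases i
    · rfl
    · rfl
  ext z
  constructor
  · rintro ⟨x, hx, rfl⟩
    rw [hsnoc]
    have hx0 := hx 0
    have hin := β.inside (x 0) hx0.1 hx0.2
    have hmem : (![x 0, β.a (x 0)] : Fin 2 → ℝ) ∈ soloInformedOpenCube 2 :=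
      soloInformed_vec2_mem_openCube.2 ⟨hx0, hin⟩
    exact ⟨hmem, (β.aeval_eq_zero_iff hmem).2 rfl⟩
  · rintro ⟨hz, hH⟩
    refine ⟨![z 0], fun j => ?_, ?_⟩
    · fin_cases j
      exact hz 0
    · rw [hsnoc]
      have h1 : z 1 = β.a (z 0) := (β.aeval_eq_zero_iff hz).1 hH
      funext i
      fin_cases i
      · rfl
      · exact h1

/-- **The branch is `ℚ`-semialgebraic on `(0,1)`.** [this work] -/
theorem isSemialgebraicFunOn_a (β : SoloInformedUnitBranch K)
    (hK : ∀ c : K, IsAlgebraic ℚ (algebraMap K ℝ c)) :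
    IsSemialgebraicFunOn ℚ (soloInformedOpenCube 1) (fun x => β.a (x 0)) := by
  have hO := isSemialgebraic_soloInformedOpenCube 2
  have h1 := (soloInformed_isSemialgebraicFunOn_aevalK hK hO β.H).isSemialgebraic_sep_nonneg
  have h2 := (soloInformed_isSemialgebraicFunOn_aevalK hK hO (-β.H)).isSemialgebraic_sep_nonneg
  have hgraph : IsSemialgebraic ℚ
      {z | z ∈ soloInformedOpenCube 2 ∧ (MvPolynomial.aeval z β.H : ℝ) = 0} := by
    convert h1.inter h2 using 1
    ext z
    simp only [mem_setOf_eq, mem_inter_iff, map_neg, neg_nonneg]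
    constructor
    · rintro ⟨hz, h⟩
      exact ⟨⟨hz, h.ge⟩, ⟨hz, h.le⟩⟩
    · rintro ⟨⟨hz, h1⟩, ⟨_, h2⟩⟩
      exact ⟨hz, le_antisymm h2 h1⟩
  unfold IsSemialgebraicFunOn
  rw [β.graph_a_eq]
  exact hgraph

/-! ### The cell leaves -/

/-- `ι(1) = 1`. -/
theorem kToC_one : (soloInformedKToC K 1 : ℂ) = 1 := map_one _

/-- `ι(0) = 0`. -/
theorem kToC_zero : (soloInformedKToC K 0 : ℂ) = 0 := map_zero _

/-- **CELL LEAF, upper piece.**  An integral representation with domain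
`{0 < x < 1, a(x) < y < 1}` and integrand `N/D`, `D ≠ 0` on the closed unit square, is
presentable. [this work] -/
theorem presentable_upper [CharZero K] (β : SoloInformedUnitBranch K)
    (hK : ∀ c : K, IsAlgebraic ℚ (algebraMap K ℝ c)) (N D : MvPolynomial (Fin 2) K)
    (hD : ∀ y ∈ soloInformedCube 2, (MvPolynomial.aeval y D : ℝ) ≠ 0) (r : IntegralRep 2)
    (hdom : r.domain = {y | 0 < y 0 ∧ y 0 < 1 ∧ β.a (y 0) < y 1 ∧ y 1 < 1})
    (hint : EqOn r.integrand
      (fun y => (MvPolynomial.aeval y N : ℝ) / MvPolynomial.aeval y D) r.domain) :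
    of r ∈ soloInformedPresentable := by
  have h1re : ((soloInformedKToC K 1 : ℂ)).re = 1 := by rw [kToC_one, Complex.one_re]
  refine soloInformed_presentable_ratBand hK N D β.H (MvPolynomial.X 1 - MvPolynomial.C 1) β.A
    (fun _ => soloInformedKToC K 1) β.V β.isOpen_V β.mem_V β.analyticA analyticOnNhd_const
    β.realA (fun _ _ => soloInformed_kToC_im 1) β.H_ne β.zero (soloInformed_X_sub_C_ne_zero 1)
    (fun z _ => soloInformed_evalC_X_sub_C 1 z) (fun y hy => ?_) (fun s hs0 hs1 => ?_)
    (β.isSemialgebraicFunOn_a hK)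
    (soloInformed_isSemialgebraicFunOn_constK hK 1 (isSemialgebraic_soloInformedOpenCube 1))
    r ?_ hint
  · -- the straightened closed square avoids `D = 0`
    have hy0 := hy 0
    have hy1 := hy 1
    have hAr := β.realA (y 0) (β.mem_V _ hy0)
    have ha := β.a_mem_Icc hy0
    rw [soloInformed_bandPt_toC β.A _ y hAr (soloInformed_kToC_im 1),
      ← soloInformed_ofReal_aevalK, Complex.ofReal_ne_zero, h1re]
    refine hD _ (soloInformed_vec2_mem_cube.2 ⟨hy0, ?_, ?_⟩)
    · change 0 ≤ β.a (y 0) + y 1 * (1 - β.a (y 0))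
      nlinarith [ha.1, ha.2, hy1.1, hy1.2]
    · change β.a (y 0) + y 1 * (1 - β.a (y 0)) ≤ 1
      nlinarith [ha.1, ha.2, hy1.1, hy1.2]
  · -- `a < 1` on `(0,1)`
    rw [h1re]
    exact (β.inside s hs0 hs1).2
  · -- the domain is the band
    rw [hdom]
    ext y
    simp only [soloInformedBand, mem_setOf_eq, h1re]
    rfl

/-- **CELL LEAF, lower piece.**  An integral representation with domain
`{0 < x < 1, 0 < y < a(x)}` and integrand `N/D`, `D ≠ 0` on the closed unit square, is
presentable. [this work] -/
theorem presentable_lower [CharZero K] (β : SoloInformedUnitBranch K)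
    (hK : ∀ c : K, IsAlgebraic ℚ (algebraMap K ℝ c)) (N D : MvPolynomial (Fin 2) K)
    (hD : ∀ y ∈ soloInformedCube 2, (MvPolynomial.aeval y D : ℝ) ≠ 0) (r : IntegralRep 2)
    (hdom : r.domain = {y | 0 < y 0 ∧ y 0 < 1 ∧ 0 < y 1 ∧ y 1 < β.a (y 0)})
    (hint : EqOn r.integrand
      (fun y => (MvPolynomial.aeval y N : ℝ) / MvPolynomial.aeval y D) r.domain) :
    of r ∈ soloInformedPresentable := by
  have h0re : ((soloInformedKToC K 0 : ℂ)).re = 0 := by rw [kToC_zero, Complex.zero_re]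
  refine soloInformed_presentable_ratBand hK N D (MvPolynomial.X 1 - MvPolynomial.C 0) β.H
    (fun _ => soloInformedKToC K 0) β.A β.V β.isOpen_V β.mem_V analyticOnNhd_const β.analyticA
    (fun _ _ => soloInformed_kToC_im 0) β.realA (soloInformed_X_sub_C_ne_zero 0)
    (fun z _ => soloInformed_evalC_X_sub_C 0 z) β.H_ne β.zero (fun y hy => ?_)
    (fun s hs0 hs1 => ?_)
    (soloInformed_isSemialgebraicFunOn_constK hK 0 (isSemialgebraic_soloInformedOpenCube 1))
    (β.isSemialgebraicFunOn_a hK) r ?_ hint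
  · -- the straightened closed square avoids `D = 0`
    have hy0 := hy 0
    have hy1 := hy 1
    have hAr := β.realA (y 0) (β.mem_V _ hy0)
    have ha := β.a_mem_Icc hy0
    rw [soloInformed_bandPt_toC _ β.A y (soloInformed_kToC_im 0) hAr,
      ← soloInformed_ofReal_aevalK, Complex.ofReal_ne_zero, h0re]
    refine hD _ (soloInformed_vec2_mem_cube.2 ⟨hy0, ?_, ?_⟩)
    · change 0 ≤ 0 + y 1 * (β.a (y 0) - 0)
      nlinarith [ha.1, ha.2, hy1.1, hy1.2]
    · change 0 + y 1 * (β.a (y 0) - 0) ≤ 1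
      nlinarith [ha.1, ha.2, hy1.1, hy1.2]
  · -- `0 < a` on `(0,1)`
    rw [h0re]
    exact (β.inside s hs0 hs1).1
  · -- the domain is the band
    rw [hdom]
    ext y
    simp only [soloInformedBand, mem_setOf_eq, h0re]
    rfl

end SoloInformedUnitBranch

end Summit.KontsevichZagierPeriods.KontsevichZagierPeriods.Theorems
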